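import Mathlib.Geometry.Manifold.IntegralCurve.ExistUnique
import Literature.Geometry.Manifold.FlowBox
import HarnessLib

/-!
# In a flow box the flow is a translation

Topic `Geometry/Manifold` (general differential topology), companion of
`Literature.Geometry.Manifold.FlowBox` (Lee, *Introduction to Smooth Manifolds*, 2nd ed.,
Thm. 9.22: a chart `ψ` about a regular point `p` of a vector field `V` in which `V` is the constant
field `v = V p`, `exists_chart_mfderiv_eq_const`). The point of the canonical form is the remark
following Lee's Thm. 9.22 (and Thm. 9.20 (c)): *in such coordinates the flow of `V` is
`θₜ(s¹, …, sⁿ) = (s¹ + t, s², …, sⁿ)`*, i.e. the integral curves are the coordinate lines. This file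
proves that statement for a flow `θ : ℝ × M → M` of `V` given as data (`θ(0, p) = p`, each
`t ↦ θ(t, p)` an integral curve; such a flow exists for complete fields,
`Literature.Geometry.Manifold.exists_contMDiff_globalFlow_of_complete`):

* `isMIntegralCurveOn_symm_add_smul` — the straight line `s ↦ ψ⁻¹(a + s v)` through a flow box is
  an integral curve of `V` as long as `a + s v` stays in the chart target (chain rule and
  `d(ψ⁻¹)(v) = V`);
* `flow_eq_symm_add_smul` — hence, by uniqueness of integral curves on a Hausdorff manifold
  (Mathlib's `isMIntegralCurveOn_Ioo_eqOn_of_contMDiff_boundaryless`), **`θ(s, x) = ψ⁻¹(ψ x + s v)`**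
  for `x` in the box and `s` in an interval about `0` along which the line stays in the target;
* `exists_nhds_flow_eq_symm_add_smul` — a uniform version: a neighbourhood `N` of a point of the
  box and `ε > 0` such that `ψ(θ(s, x)) = ψ x + s v` for all `x ∈ N`, `|s| < ε`;
* `exists_flowBox_flow_eq` — packaged with the flow-box theorem: about every point `p` with
  `V p ≠ 0` of a `C^∞` field there is a chart of the maximal atlas in which the flow is translation
  by multiples of `V p`.

This is the local model of the orbit-space projection of a flow (slices `{s¹ = const}` are local
sections), used for the orbit space of a stationary space-time
(`Literature.Geometry.Lorentzian.StationaryOrbitSpace`). Everything is proved; no definitions, no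
named facts. Manifolds are modelled on the normed space `E` itself (`𝓘(ℝ, E)`), as in `FlowBox`.

## References

* J. M. Lee, *Introduction to Smooth Manifolds*, 2nd ed., GTM 218, Springer 2012, Thm. 9.20 (c),
  Thm. 9.22 and the discussion following it. [LeeSmoothManifolds2013]
-/

noncomputable section

open Set Metric Filter Function Bundle
open scoped Topology ContDiff Manifold

namespace Literature.Geometry.Manifold

variable {E : Type*} [NormedAddCommGroup E] [NormedSpace ℝ E] {M : Type*} [TopologicalSpace M]
  [ChartedSpace E M] [IsManifold 𝓘(ℝ, E) ∞ M]
  {V : Π x : M, TangentSpace 𝓘(ℝ, E) x} {θ : ℝ × M → M}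

/-- The line `s ↦ a + s • v` in `E` has manifold derivative `1 ↦ v` at every parameter. [folklore] -/
theorem hasMFDerivAt_const_add_smul (a v : E) (s : ℝ) :
    HasMFDerivAt 𝓘(ℝ, ℝ) 𝓘(ℝ, E) (fun s : ℝ ↦ a + s • v) s
      ((1 : ℝ →L[ℝ] ℝ).smulRight v) := by
  rw [hasMFDerivAt_iff_hasFDerivAt]
  have h : HasDerivAt (fun s : ℝ ↦ a + s • v) ((1 : ℝ) • v) s :=
    ((hasDerivAt_id s).smul_const v).const_add a
  rw [one_smul] at h
  exact h.hasFDerivAt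

omit [IsManifold 𝓘(ℝ, E) ∞ M] in
/-- **Coordinate lines of a flow box are integral curves.** Let `ψ` be a chart of the maximal `C^∞`
atlas and `v ∈ E` a vector with `d(ψ⁻¹)_{ψ x}(v) = V x` on `ψ.source` (a flow box for `V`,
`exists_chart_mfderiv_eq_const`). Then for every `a ∈ E` the line `s ↦ ψ⁻¹(a + s v)` is an
integral curve of `V` on any parameter set along which `a + s v ∈ ψ.target`. Lee 2012, Thm. 9.22
and the remark following it (the `s¹`-coordinate lines are the integral curves).
[cite: LeeSmoothManifolds2013, Thm. 9.22] -/
theorem isMIntegralCurveOn_symm_add_smul {ψ : OpenPartialHomeomorph M E}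
    (hψ : ψ ∈ IsManifold.maximalAtlas 𝓘(ℝ, E) ∞ M) {v : E}
    (hψv : ∀ x ∈ ψ.source, mfderiv 𝓘(ℝ, E) 𝓘(ℝ, E) ψ.symm (ψ x) v = V x)
    {a : E} {S : Set ℝ} (hS : ∀ s ∈ S, a + s • v ∈ ψ.target) :
    IsMIntegralCurveOn (fun s ↦ ψ.symm (a + s • v)) V S := by
  intro s hs
  have hq : a + s • v ∈ ψ.target := hS s hs
  have hx : ψ.symm (a + s • v) ∈ ψ.source := ψ.map_target hq
  -- `ψ⁻¹` is differentiable at the point of the target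
  have hd : MDifferentiableAt 𝓘(ℝ, E) 𝓘(ℝ, E) ψ.symm (a + s • v) :=
    ((contMDiffOn_symm_of_mem_maximalAtlas hψ).contMDiffAt (ψ.open_target.mem_nhds hq))
      |>.mdifferentiableAt (by simp)
  have hcomp := hd.hasMFDerivAt.comp s (hasMFDerivAt_const_add_smul a v s)
  have heq : (mfderiv 𝓘(ℝ, E) 𝓘(ℝ, E) ψ.symm (a + s • v)).comp ((1 : ℝ →L[ℝ] ℝ).smulRight v) =
      (1 : ℝ →L[ℝ] ℝ).smulRight (V (ψ.symm (a + s • v))) := by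
    apply ContinuousLinearMap.ext_ring
    show mfderiv 𝓘(ℝ, E) 𝓘(ℝ, E) ψ.symm (a + s • v) (((1 : ℝ →L[ℝ] ℝ) (1 : ℝ)) • v) =
      ((1 : ℝ →L[ℝ] ℝ) (1 : ℝ)) • V (ψ.symm (a + s • v))
    rw [show ((1 : ℝ →L[ℝ] ℝ) (1 : ℝ)) = 1 from rfl, one_smul, one_smul]
    have h := hψv _ hx
    rw [ψ.right_inv hq] at h
    exact h
  have hcomp' : HasMFDerivAt 𝓘(ℝ, ℝ) 𝓘(ℝ, E) (fun s ↦ ψ.symm (a + s • v)) s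
      ((1 : ℝ →L[ℝ] ℝ).smulRight (V (ψ.symm (a + s • v)))) := by
    convert hcomp using 1
    · rfl
    · exact heq.symm
  exact hcomp'.hasMFDerivWithinAt

variable [T2Space M]

/-- **In a flow box the flow is a translation** (Lee 2012, Thm. 9.20 (c) and the remark after
Thm. 9.22: in canonical coordinates the flow is `(s¹, …, sⁿ) ↦ (s¹ + t, s², …, sⁿ)`). Let `θ` be a
flow of the `C¹` field `V` (`θ(0, p) = p`, `t ↦ θ(t, p)` integral curves) on a Hausdorff manifold,
`ψ` a chart of the maximal atlas with `d(ψ⁻¹)(v) = V` on its source, `x ∈ ψ.source`, and `(a, b)` an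
interval about `0` with `ψ x + s v ∈ ψ.target` for `s ∈ (a, b)`. Then `θ(s, x) = ψ⁻¹(ψ x + s v)` for
all `s ∈ (a, b)` (uniqueness of integral curves). [cite: LeeSmoothManifolds2013, Thm. 9.22] -/
theorem flow_eq_symm_add_smul {ψ : OpenPartialHomeomorph M E}
    (hψ : ψ ∈ IsManifold.maximalAtlas 𝓘(ℝ, E) ∞ M) {v : E}
    (hψv : ∀ x ∈ ψ.source, mfderiv 𝓘(ℝ, E) 𝓘(ℝ, E) ψ.symm (ψ x) v = V x)
    (hV : ContMDiff 𝓘(ℝ, E) 𝓘(ℝ, E).tangent 1 (fun x ↦ (⟨x, V x⟩ : TangentBundle 𝓘(ℝ, E) M)))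
    (hθV : ∀ p, IsMIntegralCurve (fun t ↦ θ (t, p)) V) (hθ0 : ∀ p, θ (0, p) = p)
    {x : M} (hx : x ∈ ψ.source) {a b : ℝ} (ha : a < 0) (hb : 0 < b)
    (hseg : ∀ s ∈ Ioo a b, ψ x + s • v ∈ ψ.target) {s : ℝ} (hs : s ∈ Ioo a b) :
    θ (s, x) = ψ.symm (ψ x + s • v) := by
  have h := isMIntegralCurveOn_Ioo_eqOn_of_contMDiff_boundaryless (t₀ := 0) ⟨ha, hb⟩ hV
    ((hθV x).isMIntegralCurveOn _) (isMIntegralCurveOn_symm_add_smul hψ hψv hseg)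
    (by simp [hθ0, ψ.left_inv hx])
  exact h hs

/-- **Uniform flow box for the flow.** Under the hypotheses of `flow_eq_symm_add_smul`, every point
`p` of the box has a neighbourhood `N ⊆ ψ.source` and an `ε > 0` such that for all `x ∈ N` and
`|s| < ε` the line `ψ x + s v` stays in `ψ.target`, `θ(s, x)` stays in the box, and
`ψ(θ(s, x)) = ψ x + s v`: in the chart `ψ` the flow is translation by `s v` (Lee 2012, remark
after Thm. 9.22). [cite: LeeSmoothManifolds2013, Thm. 9.22] -/
theorem exists_nhds_flow_eq_symm_add_smul {ψ : OpenPartialHomeomorph M E}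
    (hψ : ψ ∈ IsManifold.maximalAtlas 𝓘(ℝ, E) ∞ M) {v : E}
    (hψv : ∀ x ∈ ψ.source, mfderiv 𝓘(ℝ, E) 𝓘(ℝ, E) ψ.symm (ψ x) v = V x)
    (hV : ContMDiff 𝓘(ℝ, E) 𝓘(ℝ, E).tangent 1 (fun x ↦ (⟨x, V x⟩ : TangentBundle 𝓘(ℝ, E) M)))
    (hθV : ∀ p, IsMIntegralCurve (fun t ↦ θ (t, p)) V) (hθ0 : ∀ p, θ (0, p) = p)
    {p : M} (hp : p ∈ ψ.source) :
    ∃ ε > (0 : ℝ), ∃ N : Set M, IsOpen N ∧ p ∈ N ∧ N ⊆ ψ.source ∧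
      ∀ x ∈ N, ∀ s ∈ Ioo (-ε) ε, ψ x + s • v ∈ ψ.target ∧ θ (s, x) ∈ ψ.source ∧
        θ (s, x) = ψ.symm (ψ x + s • v) ∧ ψ (θ (s, x)) = ψ x + s • v := by
  -- a ball about `ψ p` inside the target
  obtain ⟨r, hr, hball⟩ := Metric.isOpen_iff.1 ψ.open_target (ψ p) (ψ.map_source hp)
  set ε : ℝ := r / (2 * (‖v‖ + 1)) with hε
  have hv1 : 0 < ‖v‖ + 1 := by positivity
  have hεpos : 0 < ε := by positivity
  have hεv : ε * ‖v‖ ≤ r / 2 := by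
    rw [hε, div_mul_eq_mul_div, div_le_div_iff₀ (by positivity) two_pos]
    nlinarith [norm_nonneg v]
  set N : Set M := ψ.source ∩ ψ ⁻¹' ball (ψ p) (r / 2) with hN
  refine ⟨ε, hεpos, N, ψ.isOpen_inter_preimage isOpen_ball, ⟨hp, mem_ball_self (half_pos hr)⟩,
    inter_subset_left, fun x hx s hs ↦ ?_⟩
  -- the segment `ψ x + s' v`, `|s'| < ε`, stays in the ball of radius `r`
  have hseg : ∀ s' ∈ Ioo (-ε) ε, ψ x + s' • v ∈ ψ.target := by
    intro s' hs'
    apply hball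
    rw [mem_ball, dist_eq_norm]
    have h1 : ‖ψ x - ψ p‖ < r / 2 := by
      rw [← dist_eq_norm]
      exact hx.2
    have h2 : ‖s' • v‖ ≤ ε * ‖v‖ := by
      rw [norm_smul, Real.norm_eq_abs]
      exact mul_le_mul_of_nonneg_right (abs_lt.2 hs').le (norm_nonneg v)
    calc ‖ψ x + s' • v - ψ p‖ = ‖(ψ x - ψ p) + s' • v‖ := by congr 1; abel
      _ ≤ ‖ψ x - ψ p‖ + ‖s' • v‖ := norm_add_le _ _
      _ < r / 2 + r / 2 := by linarith
      _ = r := by ring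
  have hq : ψ x + s • v ∈ ψ.target := hseg s hs
  have hθ : θ (s, x) = ψ.symm (ψ x + s • v) :=
    flow_eq_symm_add_smul hψ hψv hV hθV hθ0 hx.1 (by linarith) hεpos hseg hs
  refine ⟨hq, ?_, hθ, ?_⟩
  · rw [hθ]
    exact ψ.map_target hq
  · rw [hθ, ψ.right_inv hq]

variable [CompleteSpace E]

/-- **Flow box for the flow of a smooth field** (Lee 2012, Thm. 9.22 with Thm. 9.20 (c)): about a
point `p` where the `C^∞` field `V` does not vanish there is a chart `ψ` of the maximal `C^∞` atlas,
`p ∈ ψ.source`, in which `V` is the constant field `V p` and in which any flow `θ` of `V` is, near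
`p` and for small times, translation by multiples of `V p`:
`ψ(θ(s, x)) = ψ x + s (V p)` (the tangent vector `V p ∈ T_p M = E` read as a vector of the model
space). [cite: LeeSmoothManifolds2013, Thm. 9.22] -/
theorem exists_flowBox_flow_eq
    (hV : ContMDiff 𝓘(ℝ, E) 𝓘(ℝ, E).tangent ∞ (fun x ↦ (⟨x, V x⟩ : TangentBundle 𝓘(ℝ, E) M)))
    (hθV : ∀ p, IsMIntegralCurve (fun t ↦ θ (t, p)) V) (hθ0 : ∀ p, θ (0, p) = p)
    {p : M} (hp : V p ≠ 0) :
    ∃ ψ ∈ IsManifold.maximalAtlas 𝓘(ℝ, E) ∞ M, p ∈ ψ.source ∧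
      (∀ x ∈ ψ.source, mfderiv 𝓘(ℝ, E) 𝓘(ℝ, E) ψ x (V x) = V p) ∧
      (∀ x ∈ ψ.source, mfderiv 𝓘(ℝ, E) 𝓘(ℝ, E) ψ.symm (ψ x) (V p) = V x) ∧
      ∃ ε > (0 : ℝ), ∃ N : Set M, IsOpen N ∧ p ∈ N ∧ N ⊆ ψ.source ∧
        ∀ x ∈ N, ∀ s ∈ Ioo (-ε) ε, ψ x + s • (show E from V p) ∈ ψ.target ∧ θ (s, x) ∈ ψ.source ∧
          θ (s, x) = ψ.symm (ψ x + s • (show E from V p)) ∧ ψ (θ (s, x)) = ψ x + s • (show E from V p) := by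
  obtain ⟨ψ, hψ, hpψ, -, hψV, hψv⟩ :=
    exists_chart_mfderiv_eq_const (V := V) isOpen_univ (hV.contMDiffOn (s := univ)) (mem_univ p) hp
  have hV1 : ContMDiff 𝓘(ℝ, E) 𝓘(ℝ, E).tangent 1
      (fun x ↦ (⟨x, V x⟩ : TangentBundle 𝓘(ℝ, E) M)) := hV.of_le (by exact_mod_cast le_top)
  exact ⟨ψ, hψ, hpψ, hψV, hψv,
    exists_nhds_flow_eq_symm_add_smul hψ hψv hV1 hθV hθ0 hpψ⟩

end Literature.Geometry.Manifold

end
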